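import Summits.KontsevichZagierPeriods.KontsevichZagierPeriods.Theorems.HurwitzMicroSectorsNormalFormPrincipleM2FiveZetaTwo
import Literature.NumberTheory.Transcendental.EllIterRep

/-!
# `NormalFormPrinciple` (stmt-KontsevichZagierPeriods-3869), line `SketchIdeator1` — leaf `stub_boxRigidity`,
# dimension two off the product type (`CatalanTwoWays`, half-angle/Möbius/Catalan side): the Möbius lifts

With `t₈ = √2 − 1 = tan(π/8)` (so `t₈² + 2t₈ − 1 = 0`), the two Möbius base changes
`u = μ₁(s) = (s + t₈)/(1 − s t₈) = tan(arctan s + π/8)` (increasing, `(0, t₈) → (t₈, 1)`) and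
`u = μ₂(s) = (t₈ − s)/(1 + t₈ s) = tan(π/8 − arctan s)` (decreasing, `(0, t₈) → (0, t₈)`)
satisfy `|μᵢ'|/(1 + μᵢ²) = 1/(1 + s²)`, and the Möbius factors are `c₁ = 1/μ₁`, `c₂ = 1/μ₂`.
Hence the lifted maps `(s, t) ↦ (μᵢ(s), t)` carry the unfolded monomials
`M₁ = [{0<s<t₈, 1 ≤ t ≤ c₁(s)}, (1/(1+s²))/t]`, `M₂ = [{0<s<t₈, 1 ≤ t ≤ c₂(s)}, (1/(1+s²))/t]`
onto `K₂ = [{t₈<u<1, 1 ≤ t ≤ 1/u}, (1/(1+u²))/t]`, `K₁ = [{0<u<t₈, 1 ≤ t ≤ 1/u}, (1/(1+u²))/t]`,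
each by ONE instance of Kontsevich–Zagier's rule 2) (`KZ.of_sub_of_mem_relations_covLift` with
`n = 1`, derivative `μᵢ'(s) • id` on `ℝ¹`). The one-dimensional lift `covLift_one` is adapted
from `Summit.KontsevichZagierPeriods.K2SymbolChains.ClausenPi.of_sub_of_mem_relations_covLift_one`
(integrands prescribed only on the domains). Pure bookkeeping over the rule-2) engine; no new
definitions.
References: M. Kontsevich, D. Zagier, *Periods* (2001), §1.2.
-/

noncomputable section

open MeasureTheory Set
open Literature.NumberTheory.Transcendental Literature.NumberTheory.Transcendental.KZ
open Literature.ModelTheory.ExponentialFields (IsSemialgebraic)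

namespace Summit.KontsevichZagierPeriods.HurwitzMicroSectors.NormalFormPrinciple.PiBox.M2

/-- Facts about `t₈ = √2 − 1 = tan(π/8)`: `t₈² = 1 − 2t₈`, `2/5 < t₈ < 1/2`, and `t₈` is
algebraic over `ℚ` (`√2` is a root of `X² − 2`). -/
private theorem tan_pi_div_eight_facts :
    (Real.sqrt 2 - 1) ^ 2 = 1 - 2 * (Real.sqrt 2 - 1) ∧ 2 / 5 < Real.sqrt 2 - 1 ∧
      Real.sqrt 2 - 1 < 1 / 2 ∧ IsAlgebraic ℚ (Real.sqrt 2 - 1) := by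
  have hr2 : Real.sqrt 2 ^ 2 = 2 := Real.sq_sqrt (by norm_num)
  have hr1 : 7 / 5 < Real.sqrt 2 := by
    rw [Real.lt_sqrt (by norm_num)]
    norm_num
  have hr3 : Real.sqrt 2 < 3 / 2 := by
    rw [Real.sqrt_lt' (by norm_num)]
    norm_num
  have halg : IsAlgebraic ℚ (Real.sqrt 2) := by
    refine ⟨Polynomial.X ^ 2 - Polynomial.C 2, Polynomial.X_pow_sub_C_ne_zero two_pos 2, ?_⟩
    simp [hr2]
  exact ⟨by linear_combination hr2, by linarith, by linarith, halg.sub isAlgebraic_one⟩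

/-- **A change of variable of the one-dimensional base lifts to the unfolded monomials** (rule 2)
along `(x, u) ↦ (φ x, u)`, `KZ.of_sub_of_mem_relations_covLift` with `n = 1` and derivative
`φ'(x) • id` on `ℝ¹`, of determinant `φ'(x)`): for `φ` `ℚ`-semialgebraic and differentiable on
`σ ⊆ ℝ¹`, injective there with image `σ'`, edges `v = v' ∘ φ` and weight `g = (g ∘ φ) · |φ'|` on
`σ`, any two representations on the bands `{x ∈ σ, 1 ≤ u ≤ v x}`, `{y ∈ σ', 1 ≤ u ≤ v' y}` whose
integrands are `g(x)/u`, `g(y)/u` on their domains differ by a relation.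
[cite: KontsevichZagier2001, §1.2] -/
private theorem covLift_one {σ σ' : Set (Fin 1 → ℝ)} {φ φ' : ℝ → ℝ}
    (hφ : IsSemialgebraicFunOn ℚ σ fun x => φ (x 0))
    (hder : ∀ x ∈ σ, HasDerivAt φ (φ' (x 0)) (x 0))
    (hinj : ∀ x ∈ σ, ∀ y ∈ σ, φ (x 0) = φ (y 0) → x 0 = y 0)
    (himage : (fun x : Fin 1 → ℝ => (fun _ : Fin 1 => φ (x 0))) '' σ = σ')
    {v v' : (Fin 1 → ℝ) → ℝ} (hvv' : ∀ x ∈ σ, v x = v' (fun _ => φ (x 0)))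
    {g : ℝ → ℝ} (hg : ∀ x ∈ σ, g (x 0) = g (φ (x 0)) * |φ' (x 0)|)
    (r r' : IntegralRep 2) (hr : r.domain = KZlog.band σ (fun _ => 1) v)
    (hri : EqOn r.integrand (fun z => g (z 0) / z 1) r.domain)
    (hr' : r'.domain = KZlog.band σ' (fun _ => 1) v')
    (hri' : EqOn r'.integrand (fun z => g (z 0) / z 1) r'.domain) :
    of r - of r' ∈ relations := by
  -- adapted from `…K2SymbolChains.ClausenPi.of_sub_of_mem_relations_covLift_one`
  have hσ : IsSemialgebraic ℚ σ := IsSemialgebraicFunOn.isSemialgebraic_holds hφ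
  set Φ : (Fin 1 → ℝ) → (Fin 1 → ℝ) := fun x _ => φ (x 0) with hΦ
  set Φ' : (Fin 1 → ℝ) → (Fin 1 → ℝ) →L[ℝ] (Fin 1 → ℝ) := fun x =>
    φ' (x 0) • ContinuousLinearMap.id ℝ (Fin 1 → ℝ) with hΦ'
  have hdet : ∀ x, (Φ' x).det = φ' (x 0) := fun x => by
    simp [hΦ', ContinuousLinearMap.det, LinearMap.det_smul]
  have hΦd : ∀ x ∈ σ, HasFDerivWithinAt Φ (Φ' x) σ x := by
    intro x hx
    refine HasFDerivAt.hasFDerivWithinAt ?_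
    rw [hasFDerivAt_pi']
    intro i
    have h1 : HasFDerivAt (fun y : Fin 1 → ℝ => φ (y 0))
        (φ' (x 0) • ContinuousLinearMap.proj (R := ℝ) (φ := fun _ : Fin 1 => ℝ) 0) x :=
      (hder x hx).comp_hasFDerivAt x (hasFDerivAt_apply 0 x)
    refine h1.congr_fderiv (ContinuousLinearMap.ext fun w => ?_)
    simp [hΦ', Fin.fin_one_eq_zero i]
  have hΦs : IsSemialgebraicMapOn ℚ σ Φ := IsSemialgebraicMapOn.of_forall hσ fun _ => hφ
  have hΦi : InjOn Φ σ := by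
    intro x hx y hy h
    have h0 : φ (x 0) = φ (y 0) := congrFun h 0
    funext i
    rw [Fin.fin_one_eq_zero i]
    exact hinj x hx y hy h0
  refine of_sub_of_mem_relations_covLift hΦs hΦd hΦi (v := v) (v' := v') hvv' r r' hr
    (by rw [hr', ← himage]) fun z hz => ?_
  have hz' := hz
  rw [hr] at hz'
  obtain ⟨hx, h1, h2⟩ := hz'
  have hmem : (Fin.snoc (Φ (Fin.init z)) (z (Fin.last 1)) : Fin 2 → ℝ) ∈ r'.domain := by
    rw [hr', KZlog.snoc_mem_band, ← himage]
    exact ⟨mem_image_of_mem _ hx, h1, (hvv' _ hx) ▸ h2⟩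
  have hgz : g (z 0) = g (φ (z 0)) * |φ' (z 0)| := hg _ hx
  rw [hri hz, hri' hmem, hdet]
  show g (z 0) / z 1 = g (φ (z 0)) / z 1 * |φ' (z 0)|
  rw [hgz]
  ring

/-- **The Möbius lifts** (Kontsevich–Zagier rule 2) twice, via `covLift_one`). With
`t₈ = √2 − 1`: the base change `u = (s + t₈)/(1 − s t₈)` carries
`[{0<s<t₈, 1 ≤ t ≤ (1 − s t₈)/(s + t₈)}, (1/(1+s²))/t]` to
`[{t₈<u<1, 1 ≤ t ≤ 1/u}, (1/(1+u²))/t]`, and `u = (t₈ − s)/(1 + t₈ s)` carries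
`[{0<s<t₈, 1 ≤ t ≤ (1 + t₈ s)/(t₈ − s)}, (1/(1+s²))/t]` to
`[{0<u<t₈, 1 ≤ t ≤ 1/u}, (1/(1+u²))/t]`; in both cases `(1/(1+u²)) |du/ds| = 1/(1+s²)` and
the upper edge is `1/u` (images: `u ↦ (u − t₈)/(1 + u t₈)`, resp. the involution `μ₂`, invert
the base changes, using `t₈² = 1 − 2t₈`). [cite: KontsevichZagier2001, §1.2] -/
theorem moebius_lifts :
    (∀ (M₁ K₂ : IntegralRep 2),
      M₁.domain = KZlog.band {y : Fin 1 → ℝ | 0 < y 0 ∧ y 0 < Real.sqrt 2 - 1} (fun _ => (1:ℝ))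
        (fun y => (1 - y 0 * (Real.sqrt 2 - 1)) / (y 0 + (Real.sqrt 2 - 1))) →
      EqOn M₁.integrand (fun z => (1 / (1 + z 0 ^ 2)) / z 1) M₁.domain →
      K₂.domain = KZlog.band {y : Fin 1 → ℝ | Real.sqrt 2 - 1 < y 0 ∧ y 0 < 1} (fun _ => (1:ℝ))
        (fun y => 1 / y 0) →
      EqOn K₂.integrand (fun z => (1 / (1 + z 0 ^ 2)) / z 1) K₂.domain →
      of M₁ - of K₂ ∈ relations) ∧
    (∀ (M₂ K₁ : IntegralRep 2),
      M₂.domain = KZlog.band {y : Fin 1 → ℝ | 0 < y 0 ∧ y 0 < Real.sqrt 2 - 1} (fun _ => (1:ℝ))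
        (fun y => (1 + (Real.sqrt 2 - 1) * y 0) / ((Real.sqrt 2 - 1) - y 0)) →
      EqOn M₂.integrand (fun z => (1 / (1 + z 0 ^ 2)) / z 1) M₂.domain →
      K₁.domain = KZlog.band {y : Fin 1 → ℝ | 0 < y 0 ∧ y 0 < Real.sqrt 2 - 1} (fun _ => (1:ℝ))
        (fun y => 1 / y 0) →
      EqOn K₁.integrand (fun z => (1 / (1 + z 0 ^ 2)) / z 1) K₁.domain →
      of M₂ - of K₁ ∈ relations) := by
  obtain ⟨ht, ht1, ht2, halg⟩ := tan_pi_div_eight_facts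
  set t := Real.sqrt 2 - 1 with ht_def
  have hσ : IsSemialgebraic ℚ {y : Fin 1 → ℝ | 0 < y 0 ∧ y 0 < t} :=
    (isSemialgebraic_setOf_const_lt_apply isAlgebraic_zero 0).inter
      (isSemialgebraic_setOf_apply_lt_const halg 0)
  have hX : IsSemialgebraicFunOn ℚ {y : Fin 1 → ℝ | 0 < y 0 ∧ y 0 < t} fun y => y 0 :=
    isSemialgebraicFunOn_apply hσ 0
  have hT : IsSemialgebraicFunOn ℚ {y : Fin 1 → ℝ | 0 < y 0 ∧ y 0 < t} fun _ => t :=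
    isSemialgebraicFunOn_const_of_isAlgebraic hσ halg
  have hO : IsSemialgebraicFunOn ℚ {y : Fin 1 → ℝ | 0 < y 0 ∧ y 0 < t} fun _ => ((1:ℚ) : ℝ) :=
    isSemialgebraicFunOn_ratCast hσ 1
  constructor
  · intro M₁ K₂ hM₁d hM₁i hK₂d hK₂i
    -- denominators `1 − s t₈ > 0` on `(0, t₈)`
    have hD : ∀ x ∈ {y : Fin 1 → ℝ | 0 < y 0 ∧ y 0 < t}, 0 < 1 - x 0 * t := fun x hx => by
      obtain ⟨hx0, hxt⟩ := hx
      nlinarith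
    refine covLift_one (φ := fun s => (s + t) / (1 - s * t))
      (φ' := fun s => (1 + t ^ 2) / (1 - s * t) ^ 2) (g := fun s => 1 / (1 + s ^ 2))
      ?_ ?_ ?_ ?_ ?_ ?_ M₁ K₂ hM₁d hM₁i hK₂d hK₂i
    · exact ((IsSemialgebraicFunOn.add_holds hX hT).div (IsSemialgebraicFunOn.sub_holds hO
        (IsSemialgebraicFunOn.mul_holds hX hT)) fun x hx => by
          simpa using (hD x hx).ne').congr fun x _ => by simp
    · intro x hx
      refine (((hasDerivAt_id' (x 0)).add_const t).div
        (((hasDerivAt_id' (x 0)).mul_const t).const_sub 1) (hD x hx).ne').congr_deriv ?_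
      ring
    · intro x hx y hy h
      rw [div_eq_div_iff (hD x hx).ne' (hD y hy).ne'] at h
      have key : (x 0 - y 0) * (1 + t ^ 2) = 0 := by linear_combination h
      have h1 : (1 : ℝ) + t ^ 2 ≠ 0 := by positivity
      exact sub_eq_zero.1 ((mul_eq_zero.1 key).resolve_right h1)
    · ext u
      constructor
      · rintro ⟨x, hx, rfl⟩
        have hDx := hD x hx
        obtain ⟨hx0, hxt⟩ := hx
        simp only [mem_setOf_eq]
        rw [lt_div_iff₀ hDx, div_lt_iff₀ hDx]
        constructor
        · nlinarith [mul_nonneg hx0.le (sq_nonneg t)]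
        · nlinarith [mul_pos (sub_pos.2 hxt) (by linarith : (0:ℝ) < 1 + t)]
      · rintro ⟨hut, hu1⟩
        have hE : 0 < 1 + u 0 * t := by nlinarith
        refine ⟨fun _ => (u 0 - t) / (1 + u 0 * t), ⟨div_pos (sub_pos.2 hut) hE, ?_⟩, ?_⟩
        · show (u 0 - t) / (1 + u 0 * t) < t
          rw [div_lt_iff₀ hE]
          nlinarith [mul_pos (sub_pos.2 hu1) (by linarith : (0:ℝ) < t)]
        · funext i
          have hnum : (u 0 - t) / (1 + u 0 * t) + t = u 0 * (1 + t ^ 2) / (1 + u 0 * t) := by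
            field_simp
            ring
          have hden : 1 - (u 0 - t) / (1 + u 0 * t) * t = (1 + t ^ 2) / (1 + u 0 * t) := by
            field_simp
            ring
          have h1 : (1 : ℝ) + t ^ 2 ≠ 0 := by positivity
          obtain rfl : i = 0 := Fin.fin_one_eq_zero i
          simp only
          rw [hnum, hden, div_div_div_cancel_right₀ hE.ne', mul_div_cancel_right₀ _ h1]
    · intro x _
      simp only [one_div_div]
    · intro x hx
      have hDx := hD x hx
      have h1 : (1 : ℝ) + x 0 ^ 2 ≠ 0 := by positivity
      have h1' : (1 : ℝ) + t ^ 2 ≠ 0 := by positivity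
      have hE : (1 - x 0 * t) ^ 2 ≠ 0 := pow_ne_zero 2 hDx.ne'
      have key : 1 + ((x 0 + t) / (1 - x 0 * t)) ^ 2 =
          (1 + x 0 ^ 2) * (1 + t ^ 2) / (1 - x 0 * t) ^ 2 := by
        rw [div_pow, eq_div_iff hE, add_mul, one_mul, div_mul_cancel₀ _ hE]
        ring
      rw [abs_of_pos (div_pos (by positivity) (pow_pos hDx 2)), key, one_div_div,
        div_mul_div_comm, eq_div_iff (mul_ne_zero (mul_ne_zero h1 h1') hE), one_div_mul_eq_div,
        div_eq_iff h1]
      ring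
  · intro M₂ K₁ hM₂d hM₂i hK₁d hK₁i
    -- denominators `1 + t₈ s > 0` on `(0, t₈)`
    have hD : ∀ x ∈ {y : Fin 1 → ℝ | 0 < y 0 ∧ y 0 < t}, 0 < 1 + t * x 0 := fun x hx => by
      obtain ⟨hx0, hxt⟩ := hx
      nlinarith
    refine covLift_one (φ := fun s => (t - s) / (1 + t * s))
      (φ' := fun s => -((1 + t ^ 2) / (1 + t * s) ^ 2)) (g := fun s => 1 / (1 + s ^ 2))
      ?_ ?_ ?_ ?_ ?_ ?_ M₂ K₁ hM₂d hM₂i hK₁d hK₁i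
    · exact ((IsSemialgebraicFunOn.sub_holds hT hX).div (IsSemialgebraicFunOn.add_holds hO
        (IsSemialgebraicFunOn.mul_holds hT hX)) fun x hx => by
          simpa using (hD x hx).ne').congr fun x _ => by simp
    · intro x hx
      refine (((hasDerivAt_id' (x 0)).const_sub t).div
        (((hasDerivAt_id' (x 0)).const_mul t).const_add 1) (hD x hx).ne').congr_deriv ?_
      ring
    · intro x hx y hy h
      rw [div_eq_div_iff (hD x hx).ne' (hD y hy).ne'] at h
      have key : (x 0 - y 0) * (1 + t ^ 2) = 0 := by linear_combination -h
      have h1 : (1 : ℝ) + t ^ 2 ≠ 0 := by positivity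
      exact sub_eq_zero.1 ((mul_eq_zero.1 key).resolve_right h1)
    · ext u
      constructor
      · rintro ⟨x, hx, rfl⟩
        have hDx := hD x hx
        obtain ⟨hx0, hxt⟩ := hx
        simp only [mem_setOf_eq]
        rw [lt_div_iff₀ hDx, div_lt_iff₀ hDx]
        constructor
        · nlinarith
        · nlinarith [mul_nonneg hx0.le (sq_nonneg t)]
      · rintro ⟨hu0, hut⟩
        have hE : 0 < 1 + t * u 0 := by nlinarith
        refine ⟨fun _ => (t - u 0) / (1 + t * u 0), ⟨div_pos (sub_pos.2 hut) hE, ?_⟩, ?_⟩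
        · show (t - u 0) / (1 + t * u 0) < t
          rw [div_lt_iff₀ hE]
          nlinarith [mul_pos hu0 (by positivity : (0:ℝ) < t ^ 2)]
        · funext i
          have hnum : t - (t - u 0) / (1 + t * u 0) = u 0 * (1 + t ^ 2) / (1 + t * u 0) := by
            field_simp
            ring
          have hden : 1 + t * ((t - u 0) / (1 + t * u 0)) = (1 + t ^ 2) / (1 + t * u 0) := by
            field_simp
            ring
          have h1 : (1 : ℝ) + t ^ 2 ≠ 0 := by positivity
          obtain rfl : i = 0 := Fin.fin_one_eq_zero i
          simp only
          rw [hnum, hden, div_div_div_cancel_right₀ hE.ne', mul_div_cancel_right₀ _ h1]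
    · intro x _
      simp only [one_div_div]
    · intro x hx
      have hDx := hD x hx
      have h1 : (1 : ℝ) + x 0 ^ 2 ≠ 0 := by positivity
      have h1' : (1 : ℝ) + t ^ 2 ≠ 0 := by positivity
      have hE : (1 + t * x 0) ^ 2 ≠ 0 := pow_ne_zero 2 hDx.ne'
      have key : 1 + ((t - x 0) / (1 + t * x 0)) ^ 2 =
          (1 + x 0 ^ 2) * (1 + t ^ 2) / (1 + t * x 0) ^ 2 := by
        rw [div_pow, eq_div_iff hE, add_mul, one_mul, div_mul_cancel₀ _ hE]
        ring
      rw [abs_neg, abs_of_pos (div_pos (by positivity) (pow_pos hDx 2)), key, one_div_div,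
        div_mul_div_comm, eq_div_iff (mul_ne_zero (mul_ne_zero h1 h1') hE), one_div_mul_eq_div,
        div_eq_iff h1]
      ring

end Summit.KontsevichZagierPeriods.HurwitzMicroSectors.NormalFormPrinciple.PiBox.M2
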